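import Literature.NumberTheory.Automorphic.JacquetModule
import HarnessLib

/-!
# Jacquet's lemma: the Jacquet module of an admissible representation is admissible

Casselman 1995, Theorem 3.3.1 (admissible case), proved here in the abstract setting of
`Literature.NumberTheory.Automorphic.JacquetModule` (parabolic triples with an
`ParabolicTriple.IwahoriDatum`), over a field of characteristic `0`:
`Representation.isAdmissible_jacquetModule_of_charZero_holds`.

## The named fact `Representation.isAdmissible_jacquetModule` is mis-stated (and false)

That fact (file `JacquetModule`) was written in a section declaring
`[Field k] [CharZero k] … [IsTopologicalGroup G]`, and its docstring says "for `k` a field of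
characteristic `0`"; but a `def` only absorbs the section variables its body uses, so the
instances `[CharZero k]` and `[IsTopologicalGroup G]` were silently dropped and the constant
`Representation.isAdmissible_jacquetModule` is the characteristic-free statement
`∀ {k G V} [Field k] [Group G] [TopologicalSpace G] [AddCommGroup V] [Module k V], ∀ ρ t 𝓘,
ρ.IsAdmissible → (ρ.jacquetModule t).IsAdmissible`. This statement is **false**: over
`k = 𝔽₂`, for the compact abelian group `G = ∏_ℕ ℤ/2ℤ`, the representation
`V = k ⊕ k^{(ℕ)}`, `g · (a, b) = (a - ∑ⱼ bⱼ gⱼ, b)` is admissible (`V^{K_n} = k ⊕ kⁿ` for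
`K_n = {g | gⱼ = 0, j < n}`), the triple `(G, 1, G)` carries the trivial Iwahori datum
(`N̄ = 1`, `a = 1`, `K_n`), and the Jacquet module `V_G = V / k(1, 0) ≅ k^{(ℕ)}` is an
infinite-dimensional representation of the trivial group, hence not admissible
(`Representation.not_isAdmissible_jacquetModule` in the sibling file
`Literature.NumberTheory.Automorphic.JacquetLemmaCounterexample`, namespace
`Literature.NumberTheory.Automorphic.JacquetLemma.Counterexample`). The corrected statement,
fully closed (types and all instance hypotheses are binders *inside* the `Prop`), is the named
fact `Representation.isAdmissible_jacquetModule_of_charZero`, discharged below. (The neighbouring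
fact `Representation.jacquet_exact` has the same defect; it is not treated here.)

## Source and proof architecture

W. Casselman, *Introduction to the theory of admissible representations of `p`-adic reductive
groups*, draft of 1 May 1995, §3.3, pp. 35–36. There Theorem 3.3.1 is reduced, via Prop. 1.4.4
(a neighbourhood basis of compact open subgroups with Iwahori factorisation, p. 14), to
Theorem 3.3.3: *for `K₀ = N₀⁻ M₀ N₀` with an Iwahori factorisation the canonical projection
`V^{K₀} → V_N^{M₀}` is surjective*, whose proof (p. 36) rests on Theorem 3.3.4 ("Jacquet's First
Lemma": for `v ∈ V^{M₀ N₀⁻}`, `P_{K₀} v = P_{N₀} v ≡ v mod V(N)`) and its Corollary 3.3.5, on the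
contraction `a⁻¹ N₀⁻ a ⊆ N₁⁻` (Prop. 1.4.3) and on the injectivity of `π_N(a)`. We follow this
proof, with three adjustments forced by the abstract datum (no Haar measure, no uniqueness in
the factorisation, no action of `a` on `N`):

* the projector `P_K` (Casselman 1995, §2.1, p. 20: "essentially a finite sum") is the finite
  average over the orbit `{ρ k w | k ∈ K}` of a smooth vector, finite because finitely many cosets
  `c · Stab(w)` cover the compact `K` (`finite_orbit_of_isSmoothVector`,
  `exists_average_mem_fixedPoints`, `apply_average_eq`); this is where `char k = 0` enters;
* Jacquet's First Lemma is used in the form of Cor. 3.3.5 (`mk_apply_pow_mem_map_fixedPoints`):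
  if `w` is fixed by `K ∩ M` and `K ∩ N̄` then every `g ∈ K` has `g⁻¹ = n̄ m n`, so
  `ρ(g) w = ρ(n⁻¹) w ≡ w` in `V_N`, and the `K`-average of `w` has the same image as `w`; only the
  set-theoretic factorisation `K = (K ∩ N̄)(K ∩ M)(K ∩ N)` is needed;
* in the proof of Thm. 3.3.3 (`fixedPoints_jacquetModule_le_map`) the power `a^i` is chosen with
  `a^{-i} (K ∩ N̄) a^{i} ⊆ K_j ⊆ K ∩ Stab(x')`, so that the same `i` gives both
  `π_N(a^i) x̄ ∈ U := im (V^K → V_N)` and `π_N(a^i) U ⊆ U`, hence `= U` (`U` is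
  finite-dimensional by admissibility, `π_N(a^i)` is injective), and `x̄ ∈ U`.

Finally an open subgroup `L` of `M` contains some `K_n ∩ M`, so `(V_N)^L ⊆ (V_N)^{K_n ∩ M} ⊆ U`
is finite-dimensional, and `V_N` is smooth by `Representation.isSmooth_jacquetModule`.

## Namespaces

Auxiliary lemmas: `Literature.NumberTheory.Automorphic.JacquetLemma` (the counterexample lives in
the sibling file `JacquetLemmaCounterexample`). The corrected fact and its discharge are
deliberate dot-notation-style extensions of Mathlib's `Representation` namespace, next to the
fact `Representation.isAdmissible_jacquetModule` they correct.

## References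

* W. Casselman, *Introduction to the theory of admissible representations of `p`-adic reductive
  groups*, unpublished notes, draft 1 May 1995, §1.4, §2.1, §3.3.
* I. N. Bernstein, A. V. Zelevinsky, *Representations of the group `GL(n, F)` where `F` is a
  non-archimedean local field*, Russian Math. Surveys 31 (1976), §3 (not held; cited after the
  references of `JacquetModule`).
* I. N. Bernstein, A. V. Zelevinsky, *Induced representations of reductive `p`-adic groups I*,
  Ann. Sci. ÉNS 10 (1977), Prop. 2.3(e).
-/

open scoped Pointwise

namespace Literature.NumberTheory.Automorphic.JacquetLemma

open _root_.Representation

section Averaging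

variable {k G V : Type*} [Field k] [Group G] [TopologicalSpace G] [IsTopologicalGroup G]
  [AddCommGroup V] [Module k V] (ρ : Representation k G V)

/-- **Finite orbits.** If `w` is a smooth vector and the subgroup `H` is contained in a compact
set `C`, then the orbit `{ρ h w | h ∈ H}` is finite: finitely many open cosets `c · Stab(w)`
cover `C`, and `ρ h w = ρ c w` for `h ∈ c · Stab(w)`. This is the remark "the smoothness of `π`
implies that this is essentially a finite sum" of Casselman 1995, §2.1, p. 20.
[cite: Casselman1995, §2.1, p. 20] -/
theorem finite_orbit_of_isSmoothVector (H : Subgroup G) {C : Set G} (hC : IsCompact C)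
    (hHC : (H : Set G) ⊆ C) {w : V} (hw : ρ.IsSmoothVector w) :
    ((fun g : G => ρ g w) '' (H : Set G)).Finite := by
  have hUo : ∀ c : G, IsOpen ((fun g : G => c⁻¹ * g) ⁻¹' (ρ.stabilizerSubgroup w : Set G)) :=
    fun c => hw.preimage (continuous_const_mul c⁻¹)
  have hcov : C ⊆ ⋃ c : G, (fun g : G => c⁻¹ * g) ⁻¹' (ρ.stabilizerSubgroup w : Set G) := by
    intro x _
    refine Set.mem_iUnion.2 ⟨x, ?_⟩
    show x⁻¹ * x ∈ (ρ.stabilizerSubgroup w : Set G)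
    rw [inv_mul_cancel]
    exact (ρ.stabilizerSubgroup w).one_mem
  obtain ⟨s, hs⟩ := hC.elim_finite_subcover _ hUo hcov
  refine (s.finite_toSet.image fun c : G => ρ c w).subset ?_
  rintro _ ⟨h, hh, rfl⟩
  obtain ⟨c, hc, hcU⟩ := Set.mem_iUnion₂.1 (hs (hHC hh))
  have hfix : ρ (c⁻¹ * h) w = w := hcU
  refine ⟨c, Finset.mem_coe.2 hc, ?_⟩
  calc ρ c w = ρ c (ρ (c⁻¹ * h) w) := by rw [hfix]
    _ = ρ h w := by rw [← Module.End.mul_apply, ← map_mul, mul_inv_cancel_left]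

/-- **Averaging over a relatively compact subgroup** (the projector `P_H` of Casselman 1995,
§2.1, p. 20, without Haar measure): for a smooth vector `w` and a subgroup `H` inside a compact
set, over a field of characteristic `0` the vector `|O|⁻¹ ∑_{y ∈ O} y`, where
`O = {ρ h w | h ∈ H}` is the (finite) `H`-orbit of `w`, is `H`-fixed (each `ρ h`, `h ∈ H`,
permutes `O`). [cite: Casselman1995, §2.1, p. 20] -/
theorem exists_average_mem_fixedPoints [CharZero k] (H : Subgroup G) {C : Set G}
    (hC : IsCompact C) (hHC : (H : Set G) ⊆ C) {w : V} (hw : ρ.IsSmoothVector w) :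
    ∃ s : Finset V, s.Nonempty ∧ (∀ y ∈ s, ∃ h ∈ H, ρ h w = y) ∧
      ((s.card : k)⁻¹ • ∑ y ∈ s, y) ∈ ρ.fixedPoints H := by
  have hfin := finite_orbit_of_isSmoothVector ρ H hC hHC hw
  refine ⟨hfin.toFinset, ⟨w, ?_⟩, fun y hy => ?_, ?_⟩
  · exact hfin.mem_toFinset.2 ⟨1, H.one_mem, by simp⟩
  · obtain ⟨h, hh, rfl⟩ := hfin.mem_toFinset.1 hy
    exact ⟨h, hh, rfl⟩
  · rw [mem_fixedPoints]
    intro g hg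
    rw [map_smul, map_sum]
    congr 1
    refine Finset.sum_nbij' (fun y => ρ g y) (fun y => ρ g⁻¹ y) ?_ ?_ ?_ ?_ ?_
    · intro y hy
      obtain ⟨h, hh, rfl⟩ := hfin.mem_toFinset.1 hy
      refine hfin.mem_toFinset.2 ⟨g * h, H.mul_mem hg hh, ?_⟩
      show ρ (g * h) w = ρ g (ρ h w)
      rw [map_mul, Module.End.mul_apply]
    · intro y hy
      obtain ⟨h, hh, rfl⟩ := hfin.mem_toFinset.1 hy
      refine hfin.mem_toFinset.2 ⟨g⁻¹ * h, H.mul_mem (H.inv_mem hg) hh, ?_⟩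
      show ρ (g⁻¹ * h) w = ρ g⁻¹ (ρ h w)
      rw [map_mul, Module.End.mul_apply]
    · intro y _
      exact ρ.inv_self_apply g y
    · intro y _
      exact ρ.self_inv_apply g y
    · intro y _
      rfl

/-- A linear map which is constant (`= c`) on a non-empty finite set `s` takes the value `c` on
the average `|s|⁻¹ ∑_{y ∈ s} y` (characteristic `0`, so that `|s|` is invertible). [folklore] -/
theorem apply_average_eq [CharZero k] {W : Type*} [AddCommGroup W] [Module k W]
    (f : V →ₗ[k] W) {s : Finset V} (hs : s.Nonempty) {c : W} (hc : ∀ y ∈ s, f y = c) :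
    f ((s.card : k)⁻¹ • ∑ y ∈ s, y) = c := by
  rw [map_smul, map_sum, Finset.sum_congr rfl hc, Finset.sum_const, ← Nat.cast_smul_eq_nsmul k,
    smul_smul, inv_mul_cancel₀ (Nat.cast_ne_zero.2 hs.card_pos.ne'), one_smul]

end Averaging

section JacquetLemma

variable {k G V : Type*} [Field k] [CharZero k] [Group G] [TopologicalSpace G]
  [IsTopologicalGroup G] [AddCommGroup V] [Module k V] (ρ : Representation k G V)
  (t : ParabolicTriple G) (𝓘 : t.IwahoriDatum)

/-- **Jacquet's First Lemma**, in the form of Casselman's Corollary 3.3.5 and for the abstract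
Iwahori datum: let `K = K_n` and let `x` be a vector of an admissible representation fixed by
`K ∩ M` and by `a^{-i} (K ∩ N̄) a^{i}`. Then the image of `ρ(a^i) x` in the Jacquet module `V_N`
lies in the image of `V^K`. Indeed `w = ρ(a^i) x` is fixed by `K ∩ N̄` and (as `a` commutes with
`M`) by `K ∩ M`; every `g ∈ K` factors as `g⁻¹ = n̄ m n`, so `ρ(g) w = ρ(n⁻¹) w ≡ w (mod V(N))`,
and the `K`-average of `w` is a `K`-fixed vector with the same image in `V_N` as `w`
(Casselman 1995, Thm. 3.3.4 and Cor. 3.3.5, p. 35, where `P_{K₀} v = P_{N₀} v` is computed with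
Haar measure; cf. Bernstein–Zelevinsky 1976, §3). [cite: Casselman1995, Cor. 3.3.5] -/
theorem mk_apply_pow_mem_map_fixedPoints (hρ : ρ.IsAdmissible) (n i : ℕ) (x : V)
    (hxM : ∀ m ∈ 𝓘.K n ⊓ t.M, ρ m x = x)
    (hxN : ∀ nb ∈ 𝓘.K n ⊓ 𝓘.Nbar, ρ ((𝓘.a ^ i)⁻¹ * nb * 𝓘.a ^ i) x = x) :
    Coinvariants.mk (t.restrict ρ) (ρ (𝓘.a ^ i) x) ∈
      (ρ.fixedPoints (𝓘.K n)).map (Coinvariants.mk (t.restrict ρ)) := by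
  -- `w = ρ (a ^ i) x` is fixed by `K ∩ M` and by `K ∩ N̄`
  have hwM : ∀ m ∈ 𝓘.K n ⊓ t.M, ρ m (ρ (𝓘.a ^ i) x) = ρ (𝓘.a ^ i) x := by
    intro m hm
    have hc : Commute m 𝓘.a := 𝓘.a_comm m hm.2
    have hcomm : m * 𝓘.a ^ i = 𝓘.a ^ i * m := (hc.pow_right i).eq
    rw [← Module.End.mul_apply, ← map_mul, hcomm, map_mul, Module.End.mul_apply, hxM m hm]
  have hwN : ∀ nb ∈ 𝓘.K n ⊓ 𝓘.Nbar, ρ nb (ρ (𝓘.a ^ i) x) = ρ (𝓘.a ^ i) x := by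
    intro nb hnb
    have hmul : nb * 𝓘.a ^ i = 𝓘.a ^ i * ((𝓘.a ^ i)⁻¹ * nb * 𝓘.a ^ i) := by group
    rw [← Module.End.mul_apply, ← map_mul, hmul, map_mul, Module.End.mul_apply, hxN nb hnb]
  -- average `w` over `K`: a `K`-fixed vector ...
  obtain ⟨s, hsne, hsorb, hsfix⟩ := exists_average_mem_fixedPoints ρ (𝓘.K n)
    (𝓘.isCompact_K n) subset_rfl (hρ.1 (ρ (𝓘.a ^ i) x))
  refine ⟨_, hsfix, ?_⟩
  -- ... with the same image in `V_N` as `w`, since `ρ g w = ρ n⁻¹ w` for `g⁻¹ = n̄ m n ∈ K`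
  refine apply_average_eq (Coinvariants.mk (t.restrict ρ)) hsne fun y hy => ?_
  obtain ⟨g, hg, rfl⟩ := hsorb y hy
  have hg' : g⁻¹ ∈ ((𝓘.K n : Subgroup G) : Set G) := (𝓘.K n).inv_mem hg
  rw [𝓘.factorization n] at hg'
  obtain ⟨nm, hnm, n', hn', hprod⟩ := Set.mem_mul.1 hg'
  obtain ⟨nb, hnb, m, hm, rfl⟩ := Set.mem_mul.1 hnm
  have hnb' : nb ∈ 𝓘.K n ⊓ 𝓘.Nbar := hnb
  have hm' : m ∈ 𝓘.K n ⊓ t.M := hm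
  have hn'' : n' ∈ 𝓘.K n ⊓ t.N := hn'
  have hgeq : g = n'⁻¹ * (m⁻¹ * nb⁻¹) := by
    rw [← inv_inv g, ← hprod, mul_inv_rev, mul_inv_rev]
  have hρg : ρ g (ρ (𝓘.a ^ i) x) = ρ n'⁻¹ (ρ (𝓘.a ^ i) x) := by
    rw [hgeq, map_mul, Module.End.mul_apply, map_mul, Module.End.mul_apply,
      hwN _ ((𝓘.K n ⊓ 𝓘.Nbar).inv_mem hnb'), hwM _ ((𝓘.K n ⊓ t.M).inv_mem hm')]
  rw [hρg]
  have hn'N : n'⁻¹ ∈ t.N := t.N.inv_mem hn''.2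
  exact Coinvariants.mk_self_apply (t.restrict ρ)
    ⟨⟨n'⁻¹, t.N_le hn'N⟩, Subgroup.mem_subgroupOf.2 hn'N⟩ (ρ (𝓘.a ^ i) x)

/-- **Surjectivity of `V^K → (V_N)^{K ∩ M}`** (Casselman 1995, Thm. 3.3.3, p. 35, proof p. 36)
for the groups `K = K_n` of an Iwahori datum and an admissible representation over a field of
characteristic `0`: the `K_n ∩ M`-fixed vectors of the Jacquet module lie in (hence coincide
with) the image `U` of `V^{K_n}`. Given `x̄`, lift it and average the lift over `K ∩ M` to a
`(K ∩ M)`-fixed lift `x'`; choose `K_j ⊆ K ∩ Stab(x')` and `i` with `a^{-i}(K ∩ N̄)a^{i} ⊆ K_j`;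
by `mk_apply_pow_mem_map_fixedPoints` both `π_N(a^i) x̄ ∈ U` and `π_N(a^i) U ⊆ U`, so
`π_N(a^i) U = U` (`U` finite-dimensional, `π_N(a^i)` injective) and `x̄ ∈ U`.
(Cf. Bernstein–Zelevinsky 1976, §3, for `GL_n`.) [cite: Casselman1995, Thm. 3.3.3] -/
theorem fixedPoints_jacquetModule_le_map (hρ : ρ.IsAdmissible) (n : ℕ) :
    (ρ.jacquetModule t).fixedPoints ((𝓘.K n).comap t.M.subtype) ≤
      (ρ.fixedPoints (𝓘.K n)).map (Coinvariants.mk (t.restrict ρ)) := by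
  intro xbar hx
  rw [mem_fixedPoints] at hx
  haveI : Module.Finite k ↥((ρ.fixedPoints (𝓘.K n)).map (Coinvariants.mk (t.restrict ρ))) := by
    haveI : Module.Finite k ↥(ρ.fixedPoints (𝓘.K n)) :=
      hρ.2 ⟨𝓘.K n, 𝓘.isOpen_K n⟩ (𝓘.isCompact_K n)
    infer_instance
  -- step 1: lift `xbar` and average the lift over `K ∩ M`
  obtain ⟨x, rfl⟩ := Coinvariants.mk_surjective (t.restrict ρ) xbar
  obtain ⟨s, hsne, hsorb, hsfix⟩ := exists_average_mem_fixedPoints ρ (𝓘.K n ⊓ t.M)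
    (𝓘.isCompact_K n) (fun g hg => hg.1) (hρ.1 x)
  have hqx' : Coinvariants.mk (t.restrict ρ) ((s.card : k)⁻¹ • ∑ y ∈ s, y) =
      Coinvariants.mk (t.restrict ρ) x := by
    refine apply_average_eq (Coinvariants.mk (t.restrict ρ)) hsne fun y hy => ?_
    obtain ⟨m, hm, rfl⟩ := hsorb y hy
    have h := hx ⟨m, hm.2⟩ (Subgroup.mem_comap.2 hm.1)
    rwa [jacquetModule_mk] at h
  have hx'M : ∀ m ∈ 𝓘.K n ⊓ t.M,
      ρ m ((s.card : k)⁻¹ • ∑ y ∈ s, y) = (s.card : k)⁻¹ • ∑ y ∈ s, y :=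
    (ρ.mem_fixedPoints _ _).1 hsfix
  -- step 2: a small `K_j` inside `K ∩ Stab(x')`, and `i` with `a^{-i} (K ∩ N̄) a^{i} ⊆ K_j`
  have hopen : IsOpen ((𝓘.K n : Set G) ∩
      (ρ.stabilizerSubgroup ((s.card : k)⁻¹ • ∑ y ∈ s, y) : Set G)) :=
    (𝓘.isOpen_K n).inter (hρ.1 _)
  obtain ⟨j, hj⟩ := 𝓘.hasBasis_K _
    (hopen.mem_nhds ⟨(𝓘.K n).one_mem, (ρ.stabilizerSubgroup _).one_mem⟩)
  obtain ⟨i, hi⟩ := 𝓘.exists_conj_inf_Nbar_le n j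
  have hconj : ∀ nb ∈ 𝓘.K n ⊓ 𝓘.Nbar, (𝓘.a ^ i)⁻¹ * nb * 𝓘.a ^ i ∈ 𝓘.K j := by
    intro nb hnb
    have h := hi (Subgroup.smul_mem_pointwise_smul nb (ConjAct.toConjAct (𝓘.a ^ i)⁻¹) _ hnb)
    rwa [ConjAct.smul_def, ConjAct.ofConjAct_toConjAct, inv_inv] at h
  have hai : 𝓘.a ^ i ∈ t.M := pow_mem 𝓘.a_mem i
  -- step 3: `π_N(a^i) xbar ∈ U`
  have h1 : ρ.jacquetModule t ⟨𝓘.a ^ i, hai⟩ (Coinvariants.mk (t.restrict ρ) x) ∈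
      (ρ.fixedPoints (𝓘.K n)).map (Coinvariants.mk (t.restrict ρ)) := by
    rw [← hqx', jacquetModule_mk]
    exact mk_apply_pow_mem_map_fixedPoints ρ t 𝓘 hρ n i _ hx'M
      (fun nb hnb => (hj (hconj nb hnb)).2)
  -- step 4: `U` is stable under `π_N(a^i)`, hence equal to its image
  have hAU : ((ρ.fixedPoints (𝓘.K n)).map (Coinvariants.mk (t.restrict ρ))).map
      (ρ.jacquetModule t ⟨𝓘.a ^ i, hai⟩) ≤
        (ρ.fixedPoints (𝓘.K n)).map (Coinvariants.mk (t.restrict ρ)) := by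
    rintro _ ⟨u, hu, rfl⟩
    obtain ⟨v, hv, rfl⟩ := hu
    have hv' := (ρ.mem_fixedPoints _ _).1 hv
    rw [jacquetModule_mk]
    exact mk_apply_pow_mem_map_fixedPoints ρ t 𝓘 hρ n i v (fun m hm => hv' m hm.1)
      (fun nb hnb => hv' _ (hj (hconj nb hnb)).1)
  have hAinj : Function.Injective (ρ.jacquetModule t ⟨𝓘.a ^ i, hai⟩) :=
    ((ρ.jacquetModule t).apply_bijective _).1
  have hAU_eq : ((ρ.fixedPoints (𝓘.K n)).map (Coinvariants.mk (t.restrict ρ))).map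
      (ρ.jacquetModule t ⟨𝓘.a ^ i, hai⟩) =
        (ρ.fixedPoints (𝓘.K n)).map (Coinvariants.mk (t.restrict ρ)) :=
    Submodule.eq_of_le_of_finrank_le hAU
      (LinearEquiv.finrank_eq (Submodule.equivMapOfInjective _ hAinj _)).le
  -- step 5: conclude by injectivity of `π_N(a^i)`
  rw [← hAU_eq] at h1
  obtain ⟨u, hu, hAu⟩ := h1
  rwa [← hAinj hAu]

include 𝓘 in
/-- **Jacquet's lemma, theorem form** (Casselman 1995, Thm. 3.3.1, admissible case, p. 35;
from the abstract Iwahori datum, which stands in for Casselman's Prop. 1.4.4): over a field of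
characteristic `0` and for a topological group `G`, the Jacquet module of an admissible
representation with respect to a parabolic triple admitting an Iwahori datum is admissible.
Every open subgroup `L` of `M` contains some `K_n ∩ M`, so `(V_N)^L ⊆ (V_N)^{K_n ∩ M} ⊆
im (V^{K_n} → V_N)` is finite-dimensional (`fixedPoints_jacquetModule_le_map`), and `V_N` is
smooth (`Representation.isSmooth_jacquetModule`). [cite: Casselman1995, Thm. 3.3.1] -/
theorem isAdmissible_jacquetModule (hρ : ρ.IsAdmissible) : (ρ.jacquetModule t).IsAdmissible := by
  refine ⟨ρ.isSmooth_jacquetModule t hρ.1, fun L _ => ?_⟩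
  -- `L` is open in `M`: it contains `K_n ∩ M` for some `n`
  obtain ⟨O, hO, hOL⟩ := isOpen_induced_iff.1 L.isOpen
  have h1 : (1 : G) ∈ O := by
    have h : (1 : t.M) ∈ (L : Set t.M) := L.one_mem
    rw [← hOL] at h
    exact h
  obtain ⟨n, hn⟩ := 𝓘.hasBasis_K O (hO.mem_nhds h1)
  have hle : (𝓘.K n).comap t.M.subtype ≤ (L : Subgroup t.M) := by
    intro m hm
    have h : m ∈ Subtype.val ⁻¹' O := hn (Subgroup.mem_comap.1 hm)
    rw [hOL] at h
    exact h
  haveI : Module.Finite k ↥((ρ.fixedPoints (𝓘.K n)).map (Coinvariants.mk (t.restrict ρ))) := by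
    haveI : Module.Finite k ↥(ρ.fixedPoints (𝓘.K n)) :=
      hρ.2 ⟨𝓘.K n, 𝓘.isOpen_K n⟩ (𝓘.isCompact_K n)
    infer_instance
  exact Submodule.finiteDimensional_of_le
    (((ρ.jacquetModule t).fixedPoints_antitone hle).trans
      (fixedPoints_jacquetModule_le_map ρ t 𝓘 hρ n))

end JacquetLemma

end Literature.NumberTheory.Automorphic.JacquetLemma

namespace Representation

open Literature.NumberTheory.Automorphic

section CorrectedFact

universe u v w

/-- **Jacquet's lemma (corrected named fact).** For `k` a field of characteristic `0` and `G` a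
topological group: if `t = (P, M, N)` admits an Iwahori datum (Iwahori factorisation and a
contracting element, as for parabolic subgroups of reductive `p`-adic groups), then the Jacquet
module of an admissible representation of `G` on a `k`-module is admissible.
(Casselman 1995, Thm. 3.3.1 with Thm. 3.3.3, pp. 35–36; Bernstein–Zelevinsky 1977,
Prop. 2.3(e): "`r_{M,G}` carries admissible representations into admissible ones … proved by
Jacquet".)

This is the statement `Representation.isAdmissible_jacquetModule` of
`Literature.NumberTheory.Automorphic.JacquetModule` was *meant* to be: that `def` sits in a
section declaring `[CharZero k]` and `[IsTopologicalGroup G]`, but since its body mentions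
neither, Lean dropped both instance hypotheses and the resulting constant is the
characteristic-free statement, which is false (`Representation.not_isAdmissible_jacquetModule`,
file `JacquetLemmaCounterexample`). Here the statement is fully closed — the types `k, G, V` and
all seven instance hypotheses are binders of the `Prop` itself — so nothing can be dropped, and
the discharge `isAdmissible_jacquetModule_of_charZero_holds` is literally
`theorem …_holds : isAdmissible_jacquetModule_of_charZero`. [cite: Casselman1995, Thm. 3.3.1] -/
def isAdmissible_jacquetModule_of_charZero : Prop :=
  ∀ {k : Type u} {G : Type v} {V : Type w} [Field k] [CharZero k] [Group G] [TopologicalSpace G]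
    [IsTopologicalGroup G] [AddCommGroup V] [Module k V] (ρ : Representation k G V)
    (t : ParabolicTriple G) (_ : t.IwahoriDatum), ρ.IsAdmissible → (ρ.jacquetModule t).IsAdmissible

/-- **Discharge of `isAdmissible_jacquetModule_of_charZero`** (Casselman 1995, Thm. 3.3.1), by
`Literature.NumberTheory.Automorphic.JacquetLemma.isAdmissible_jacquetModule`.
[cite: Casselman1995, Thm. 3.3.1] -/
theorem isAdmissible_jacquetModule_of_charZero_holds : isAdmissible_jacquetModule_of_charZero :=
  fun ρ t 𝓘 hρ => JacquetLemma.isAdmissible_jacquetModule ρ t 𝓘 hρ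

variable {k G V : Type*} [Field k] [Group G] [TopologicalSpace G] [AddCommGroup V] [Module k V]

/-- Dot-notation form of Jacquet's lemma: `hρ.jacquetModule t 𝓘 : (ρ.jacquetModule t).IsAdmissible`
for `hρ : ρ.IsAdmissible` (Casselman 1995, Thm. 3.3.1). [cite: Casselman1995, Thm. 3.3.1] -/
theorem IsAdmissible.jacquetModule [CharZero k] [IsTopologicalGroup G] {ρ : Representation k G V}
    (hρ : ρ.IsAdmissible) (t : ParabolicTriple G) (𝓘 : t.IwahoriDatum) :
    (ρ.jacquetModule t).IsAdmissible :=
  JacquetLemma.isAdmissible_jacquetModule ρ t 𝓘 hρ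

end CorrectedFact

end Representation
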